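import Literature.AlgebraicTopology.KTheory.BottIndex6
import Literature.AlgebraicTopology.KTheory.ReducedSphereVanishing
import Mathlib.Topology.Homotopy.Product
import HarnessLib

/-!
# Reduced Bott periodicity `K̃(X ∧ S²) ≅ K̃(X)` — scratch
-/

noncomputable section

open Set Metric unitInterval Complex TopologicalSpace

namespace Literature.AlgebraicTopology.KTheory

open Literature.RingTheory.KTheory Matrix

universe u v

/-! ### The wedge `X ∨ Y ⊆ X × Y` is detected by its two slices -/

section WedgeDetect

variable {X : Type u} [TopologicalSpace X] [CompactSpace X] [T2Space X]
variable {Y : Type v} [TopologicalSpace Y] [CompactSpace Y] [T2Space Y]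

/-- `X → X ∨ Y`, `x ↦ (x, y₀)`. [folklore] -/
def wedgeInl (x₀ : X) (y₀ : Y) : C(X, ↥(prodWedgeC x₀ y₀ : Set (X × Y))) :=
  ⟨fun x ↦ ⟨(x, y₀), Or.inr rfl⟩, (continuous_id.prodMk continuous_const).subtype_mk _⟩

/-- `Y → X ∨ Y`, `y ↦ (x₀, y)`. [folklore] -/
def wedgeInr (x₀ : X) (y₀ : Y) : C(Y, ↥(prodWedgeC x₀ y₀ : Set (X × Y))) :=
  ⟨fun y ↦ ⟨(x₀, y), Or.inl rfl⟩, (continuous_const.prodMk continuous_id).subtype_mk _⟩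

/-- The closed slice `X × {y₀} ⊆ X ∨ Y`. [folklore] -/
def wedgeSliceL (x₀ : X) (y₀ : Y) : Closeds ↥(prodWedgeC x₀ y₀ : Set (X × Y)) :=
  ⟨{w | (w : X × Y).2 = y₀}, isClosed_eq (continuous_snd.comp continuous_subtype_val) continuous_const⟩

/-- Pull-back along a map with a left inverse is injective. [folklore] -/
theorem pullback_injective_of_leftInverse {X' : Type*} [TopologicalSpace X'] {Y' : Type*} [TopologicalSpace Y'] (f : C(X', Y')) (g : C(Y', X'))
    (h : g.comp f = ContinuousMap.id X') : Function.Injective (pullback g) := by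
  intro a b hab
  have := congrArg (pullback f) hab
  rwa [← AddMonoidHom.comp_apply, ← AddMonoidHom.comp_apply, ← pullback_comp, h, pullback_id] at this

/-- **`K⁰(X ∨ Y)` is detected by the two slices**: a class on the wedge vanishing on `X × {y₀}`
and on `{x₀} × Y` is zero. [cite: HusemollerFibreBundles1994, Ch. 10 Prop. 2.1] -/
theorem eq_zero_of_pullback_wedge_eq_zero (x₀ : X) (y₀ : Y) (a : K0 ↥(prodWedgeC x₀ y₀ : Set (X × Y)))
    (hL : pullback (wedgeInl x₀ y₀) a = 0) (hR : pullback (wedgeInr x₀ y₀) a = 0) : a = 0 := by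
  haveI : CompactSpace ↥(prodWedgeC x₀ y₀ : Set (X × Y)) := isCompact_iff_compactSpace.1 (prodWedgeC x₀ y₀).isClosed.isCompact
  let W := (prodWedgeC x₀ y₀ : Set (X × Y))
  let S := wedgeSliceL x₀ y₀
  -- `a` vanishes on the slice `X × {y₀}`
  have hS : resK S a = 0 := by
    -- `incl S ∘ e = wedgeInl` with `e : X → S` a homeomorphism onto
    let e : C(X, ↥(S : Set ↥W)) := ⟨fun x ↦ ⟨wedgeInl x₀ y₀ x, rfl⟩, by fun_prop⟩
    let e' : C(↥(S : Set ↥W), X) := ⟨fun s ↦ (s.1 : X × Y).1, by fun_prop⟩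
    have hee' : e.comp e' = ContinuousMap.id _ := by
      ext s
      · rfl
      · exact s.2.symm
    have hcomp : (incl (S : Set ↥W)).comp e = wedgeInl x₀ y₀ := rfl
    apply pullback_injective_of_leftInverse e' e hee'
    rw [map_zero, resK, ← AddMonoidHom.comp_apply, ← pullback_comp, hcomp]
    exact hL
  obtain ⟨b, hb, hba⟩ := exists_reduced_quotK_eq a hS
  -- `Y ≅ W/S` via `y ↦ [x₀, y]`
  let h₀ : Y → Collapse ↥W S := fun y ↦ Collapse.mk S (wedgeInr x₀ y₀ y)
  have hcont : Continuous h₀ := (Collapse.mk S).continuous.comp (wedgeInr x₀ y₀).continuous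
  have hbij : Function.Bijective h₀ := by
    constructor
    · intro y y' hyy'
      rcases (Collapse.mk_eq_mk_iff.1 hyy') with h | ⟨h1, h2⟩
      · exact congrArg (fun w : ↥W ↦ (w : X × Y).2) h
      · exact (show y = y₀ from h1).trans (show y' = y₀ from h2).symm
    · intro z
      rcases Collapse.eq_pt_or_eq_mk z with rfl | ⟨w, hw, rfl⟩
      · exact ⟨y₀, Collapse.mk_eq_pt (show (wedgeInr x₀ y₀ y₀ : ↥W) ∈ S from rfl)⟩
      · refine ⟨(w : X × Y).2, ?_⟩
        change Collapse.mk S _ = Collapse.mk S w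
        congr 1
        apply Subtype.ext
        rcases w.2 with h | h
        · exact Prod.ext h.symm rfl
        · exact absurd h hw
  let hh : Y ≃ₜ Collapse ↥W S := Continuous.homeoOfEquivCompactToT2 (f := Equiv.ofBijective h₀ hbij) hcont
  have hcomp : (Collapse.mk S).comp (wedgeInr x₀ y₀) = (hh : C(Y, Collapse ↥W S)) := rfl
  have hb0 : pullback (hh : C(Y, Collapse ↥W S)) b = 0 := by
    rw [← hcomp, pullback_comp, AddMonoidHom.comp_apply]
    change pullback (wedgeInr x₀ y₀) (quotK S b) = 0
    rw [hba]; exact hR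
  have : b = 0 := by
    apply pullback_injective_of_leftInverse (hh.symm : C(Collapse ↥W S, Y)) (hh : C(Y, Collapse ↥W S))
    · ext z; exact hh.apply_symm_apply z
    · rw [hb0, map_zero]
  rw [← hba, this, map_zero]

end WedgeDetect

/-! ### Slices of Bott classes along `X × {1}` -/

section Slices

variable {X : Type u} [TopologicalSpace X] [CompactSpace X] [T2Space X]

omit [CompactSpace X] [T2Space X] in
/-- A gluing witness identifies the slice `s^*Q` with the slice of the upper model. [cite: HusemollerFibreBundles1994, Ch. 11 Prop. 2.3] -/
theorem GluingWitness.algEquivalent_slice {m n₁ n₂ : Type*} [Fintype m] [Fintype n₁] [Fintype n₂] {Q : Matrix m m C(X × S2r, ℂ)}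
    {P₁ : Matrix n₁ n₁ C(↥(pieceUp X), ℂ)} {P₂ : Matrix n₂ n₂ C(↥(pieceDn X), ℂ)} (w : GluingWitness Q P₁ P₂) :
    AlgEquivalent (Q.map (comapRingHom sX)) (P₁.map (comapRingHom secUp)) := by
  have h : AlgEquivalent (Q.map (resHom (pieceUp X))) P₁ := ⟨w.x₁, w.y₁, w.hxy₁, w.hyx₁, w.hx₁, w.hy₁⟩
  have h' := h.map (comapRingHom (secUp (X := X)))
  have e : (Q.map (resHom (pieceUp X))).map (comapRingHom (secUp (X := X))) = Q.map (comapRingHom sX) := by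
    rw [Matrix.map_map]; rfl
  rwa [e] at h'

omit [CompactSpace X] [T2Space X] in
/-- K-theory of spheres (Hatcher VBKT §2). [folklore] -/
theorem pullUp_map_secUp (ζ : Idem C(X, ℂ)) : (pullUp ζ).map (comapRingHom (secUp (X := X))) = ζ.mat := by
  ext i j x; rfl

/-- **`s^*[ζ, u] = [ζ]`**: the slice of a clutched class along `X × {1}`. [cite: HusemollerFibreBundles1994, Ch. 11 Prop. 2.3] -/
theorem pullback_sX_bottClass {ζ : Idem C(X, ℂ)} (c : ClutchingFn ζ) : pullback sX (bottClass ζ c) = KZero.of ζ := by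
  have hQ := Classical.choose_spec (exists_isClutched ζ c)
  obtain ⟨w, -⟩ := id hQ
  rw [bottClass, pullback_of]
  apply KZero.of_eq_of
  refine ((Idem.algEquivalent_ofMatrix _ hQ.isIdempotentElem).map (comapRingHom sX)).trans ?_
  have h := w.algEquivalent_slice
  rwa [pullUp_map_secUp] at h

/-- **`s^*[θ, g] = |ι|`**: the slice of a GL-clutched class is trivial. [cite: HusemollerFibreBundles1994, Ch. 11 Prop. 2.3] -/
theorem pullback_sX_bottClassGL {ι : Type} [Fintype ι] [DecidableEq ι] {g : Matrix ι ι C(↥(pieceUp X ∩ pieceDn X), ℂ)} (hg : IsUnit g) :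
    pullback sX (bottClassGL g) = Fintype.card ι := by
  obtain ⟨q, hq⟩ := exists_idem_isClutchedGL g hg
  obtain ⟨w, -⟩ := id hq
  rw [← hq.of_eq, pullback_of, ← KZero.of_unit_eq_natCast]
  apply KZero.of_eq_of
  refine w.algEquivalent_slice.trans ?_
  rw [Matrix.map_one _ (map_zero _) (map_one _)]
  change AlgEquivalent (1 : Matrix ι ι C(X, ℂ)) (1 : Matrix (Fin (Fintype.card ι)) (Fin (Fintype.card ι)) C(X, ℂ))
  have h := AlgEquivalent.reindex (IsIdempotentElem.one (M := Matrix ι ι C(X, ℂ))) (Fintype.equivFin ι)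
  rwa [Matrix.reindex_apply, Matrix.submatrix_one_equiv] at h

/-- **`s^*γ = 1`.** [cite: HusemollerFibreBundles1994, Ch. 11 Thm. 5.4] -/
theorem pullback_sX_bottγ : pullback sX (bottγ X) = 1 := by
  rw [bottγ, pullback_sX_bottClassGL (isUnit_smul_one isUnit_zA _)]
  simp

end Slices

/-! ### The smash product `X ∧ S² = (X × S²)/(X ∨ S²)` and reduced Bott periodicity -/

section Smash

variable {X : Type u} [TopologicalSpace X] [CompactSpace X] [T2Space X]

/-- The slice `{x₀} × S² → X × S²`. [folklore] -/
abbrev jX (x₀ : X) : C(S2r, X × S2r) := (ContinuousMap.const S2r x₀).prodMk (ContinuousMap.id S2r)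

omit [CompactSpace X] [T2Space X] in
/-- `{x₀} × S²` factors through `pt × S²`. [folklore] -/
theorem jX_eq_comp (x₀ : X) : jX x₀ = (baseMap (ContinuousMap.const PUnit.{u + 1} x₀)).comp ((ContinuousMap.const S2r PUnit.unit).prodMk (ContinuousMap.id S2r)) := rfl

omit [CompactSpace X] [T2Space X] in
/-- K-theory of spheres (Hatcher VBKT §2). [folklore] -/
theorem prX_comp_baseMap {X' : Type*} [TopologicalSpace X'] (f : C(X', X)) : (prX X).comp (baseMap f) = f.comp (prX X') := rfl

/-- `(f × id)^* (pr₁^*α + pr₁^*β·γ) = pr₁^*(f^*α) + pr₁^*(f^*β)·γ`. [folklore] -/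
theorem pullback_baseMap_bottMap {X' : Type*} [TopologicalSpace X'] [CompactSpace X'] [T2Space X'] (f : C(X', X)) (α β : K0 X) :
    pullback (baseMap f) (pullback (prX X) α + pullback (prX X) β * bottγ X) = pullback (prX X') (pullback f α) + pullback (prX X') (pullback f β) * bottγ X' := by
  rw [map_add, pullback_mul, pullback_baseMap_bottγ, ← AddMonoidHom.comp_apply, ← pullback_comp, prX_comp_baseMap, pullback_comp,
    AddMonoidHom.comp_apply, ← AddMonoidHom.comp_apply (pullback (baseMap f)), ← pullback_comp, prX_comp_baseMap, pullback_comp, AddMonoidHom.comp_apply]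

/-- On a one-point space, `k • [1] = 0` forces `k = 0`. [folklore] -/
theorem unitHom_eq_zero_iff_punit (k : ℤ) : KZero.unitHom C(PUnit.{u + 1}, ℂ) k = 0 ↔ k = 0 := by
  constructor
  · intro h
    have := congrArg (rankAt PUnit.unit) h
    rwa [rankAt_unitHom, map_zero] at this
  · rintro rfl; exact map_zero _

/-- **The slice `{x₀} × S²` of `pr₁^*α + pr₁^*β·γ` vanishes iff `α` and `β` have rank `0` at `x₀`.** [cite: HusemollerFibreBundles1994, Ch. 11 Thm. 5.4] -/
theorem pullback_jX_bottMap_eq_zero_iff (x₀ : X) (α β : K0 X) :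
    pullback (jX x₀) (pullback (prX X) α + pullback (prX X) β * bottγ X) = 0 ↔ rankAt x₀ α = 0 ∧ rankAt x₀ β = 0 := by
  rw [jX_eq_comp, pullback_comp, AddMonoidHom.comp_apply, pullback_baseMap_bottMap, pullback_const, pullback_const]
  have hinj : Function.Injective (pullback ((ContinuousMap.const S2r PUnit.unit).prodMk (ContinuousMap.id S2r) : C(S2r, PUnit.{u + 1} × S2r))) :=
    pullback_injective_of_leftInverse (ContinuousMap.snd : C(PUnit.{u + 1} × S2r, S2r)) _ (by ext ⟨⟨⟩, s⟩; rfl)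
  rw [← map_zero (pullback ((ContinuousMap.const S2r PUnit.unit).prodMk (ContinuousMap.id S2r) : C(S2r, PUnit.{u + 1} × S2r))), hinj.eq_iff]
  constructor
  · intro h
    obtain ⟨h1, h2⟩ := bott_injective h
    exact ⟨(unitHom_eq_zero_iff_punit _).1 h1, (unitHom_eq_zero_iff_punit _).1 h2⟩
  · rintro ⟨h1, h2⟩
    rw [h1, h2, map_zero, map_zero, zero_mul, add_zero]

/-- The slice `X × {1}` of `pr₁^*α + pr₁^*β·γ` is `α + β`. [cite: HusemollerFibreBundles1994, Ch. 11 Thm. 5.4] -/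
theorem pullback_sX_bottMap (α β : K0 X) : pullback sX (pullback (prX X) α + pullback (prX X) β * bottγ X) = α + β := by
  rw [map_add, pullback_mul, pullback_sX_bottγ, mul_one, pullback_sX_pullback_prX, pullback_sX_pullback_prX]

/-- The slice `X × {s₀} → X × S²` at an arbitrary point of `S²`. [folklore] -/
abbrev sliceAt (s₀ : S2r) : C(X, X × S2r) := (ContinuousMap.id X).prodMk (ContinuousMap.const X s₀)

omit [CompactSpace X] [T2Space X] in
/-- All slices `X × {s₀}` are homotopic (`S²` is path connected). [folklore] -/
theorem sliceAt_homotopic (s₀ s₁ : S2r) : (sliceAt (X := X) s₀).Homotopic (sliceAt s₁) := by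
  have hconn : IsPathConnected (sphere (0 : E3) 1) := isPathConnected_sphere (by
    rw [← Module.finrank_eq_rank]; simp) 0 zero_le_one
  have hj : Joined s₀ s₁ := by
    obtain ⟨γ, hγ⟩ := hconn.joinedIn _ s₀.2 _ s₁.2
    exact ⟨⟨⟨fun t ↦ ⟨γ t, hγ t⟩, by fun_prop⟩, by ext; simp, by ext; simp⟩⟩
  rcases isEmpty_or_nonempty X with hX | hX
  · exact ⟨ContinuousMap.Homotopy.refl _ |>.cast rfl (ContinuousMap.ext fun x ↦ (IsEmpty.false x).elim)⟩
  · obtain ⟨H⟩ := (ContinuousMap.homotopic_const_iff (Y := X)).2 hj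
    exact ⟨(ContinuousMap.Homotopy.refl (ContinuousMap.id X)).prod H⟩

/-- **Every slice of `γ` is `1`**: `(x ↦ (x, s₀))^* γ = 1`. [cite: HusemollerFibreBundles1994, Ch. 11 Thm. 5.4] -/
theorem pullback_sliceAt_bottγ (s₀ : S2r) : pullback (sliceAt s₀) (bottγ X) = 1 := by
  rw [pullback_eq_of_homotopic (sliceAt_homotopic s₀ s2Base)]; exact pullback_sX_bottγ

/-- The slice `X × {s₀}` of `pr₁^*α + pr₁^*β·γ` is `α + β`. [cite: HusemollerFibreBundles1994, Ch. 11 Thm. 5.4] -/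
theorem pullback_sliceAt_bottMap (s₀ : S2r) (α β : K0 X) : pullback (sliceAt s₀) (pullback (prX X) α + pullback (prX X) β * bottγ X) = α + β := by
  rw [pullback_eq_of_homotopic (sliceAt_homotopic s₀ s2Base)]; exact pullback_sX_bottMap α β

variable [T1Space X]

/-- The wedge `X ∨ S² = X × {s₀} ∪ {x₀} × S²` (as a closed subset of `X × S²`). [folklore] -/
abbrev wedgeXS (x₀ : X) (s₀ : S2r) : Closeds (X × S2r) := prodWedgeC x₀ s₀

/-- **The smash product `X ∧ S²`.** [folklore] -/
abbrev SmashS2 (X : Type u) [TopologicalSpace X] [T1Space X] (x₀ : X) (s₀ : S2r) : Type u := Collapse (X × S2r) (wedgeXS x₀ s₀)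

/-- A class on `X × S²` vanishing on both slices vanishes on the wedge. [folklore] -/
theorem resK_wedgeXS_eq_zero {x₀ : X} {s₀ : S2r} {ξ : K0 (X × S2r)} (hL : pullback (sliceAt s₀) ξ = 0) (hR : pullback (jX x₀) ξ = 0) : resK (wedgeXS x₀ s₀) ξ = 0 := by
  refine eq_zero_of_pullback_wedge_eq_zero x₀ s₀ _ ?_ ?_
  · rw [resK, ← AddMonoidHom.comp_apply, ← pullback_comp]; exact hL
  · rw [resK, ← AddMonoidHom.comp_apply, ← pullback_comp]; exact hR

/-- The index of the image of a reduced class of `X ∧ S²` is reduced. [folklore] -/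
theorem ind_quotK_mem_reduced (x₀ : X) (s₀ : S2r) {b : K0 (SmashS2 X x₀ s₀)} (hb : b ∈ Reduced (SmashS2 X x₀ s₀) (Collapse.pt (wedgeXS x₀ s₀))) :
    ind (quotK (wedgeXS x₀ s₀) b) ∈ Reduced X x₀ := by
  obtain ⟨α, β, hξ⟩ := bott_surjective (quotK (wedgeXS x₀ s₀) b)
  have hR := pullback_sliceRight_quotK x₀ s₀ hb
  change pullback (jX x₀) (quotK (wedgeXS x₀ s₀) b) = 0 at hR
  rw [hξ, pullback_jX_bottMap_eq_zero_iff] at hR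
  rw [hξ, map_add, ind_pullback_prX, ind_pullback_prX_mul_bottγ, zero_add, mem_reduced_iff]
  exact hR.2

variable (X) in
/-- The reduced Bott map `K̃(X ∧ S²) → K̃(X)`, `b ↦ ind(q^* b)`. [cite: HusemollerFibreBundles1994, Ch. 11 Thm. 5.4] -/
def smashInd (x₀ : X) (s₀ : S2r) : Reduced (SmashS2 X x₀ s₀) (Collapse.pt (wedgeXS x₀ s₀)) →+ Reduced X x₀ :=
  AddMonoidHom.codRestrict ((ind.comp (quotK (wedgeXS x₀ s₀))).comp (AddSubgroup.subtype _)) (Reduced X x₀) fun b ↦ ind_quotK_mem_reduced x₀ s₀ b.2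

/-- K-theory of spheres (Hatcher VBKT §2). [folklore] -/
@[simp] theorem smashInd_apply (x₀ : X) (s₀ : S2r) (b : Reduced (SmashS2 X x₀ s₀) (Collapse.pt (wedgeXS x₀ s₀))) : (smashInd X x₀ s₀ b : K0 X) = ind (quotK (wedgeXS x₀ s₀) b) := rfl

/-- K-theory of spheres (Hatcher VBKT §2). [folklore] -/
theorem smashInd_injective (x₀ : X) (s₀ : S2r) : Function.Injective (smashInd X x₀ s₀) := by
  refine (injective_iff_map_eq_zero _).2 fun b hb ↦ ?_
  have hb' : ind (quotK (wedgeXS x₀ s₀) (b : K0 (SmashS2 X x₀ s₀))) = 0 := by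
    have := congrArg Subtype.val hb; exact this
  obtain ⟨α, β, hξ⟩ := bott_surjective (quotK (wedgeXS x₀ s₀) (b : K0 (SmashS2 X x₀ s₀)))
  have hL := pullback_sliceLeft_quotK x₀ s₀ b.2
  change pullback (sliceAt s₀) (quotK (wedgeXS x₀ s₀) (b : K0 _)) = 0 at hL
  rw [hξ, pullback_sliceAt_bottMap] at hL
  rw [hξ, map_add, ind_pullback_prX, ind_pullback_prX_mul_bottγ, zero_add] at hb'
  subst hb'
  rw [add_zero] at hL; subst hL
  rw [map_zero, zero_mul, add_zero] at hξ
  exact Subtype.ext (eq_zero_of_quotK_prodWedge_eq_zero x₀ s₀ b.2 hξ)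

/-- K-theory of spheres (Hatcher VBKT §2). [folklore] -/
theorem smashInd_surjective (x₀ : X) (s₀ : S2r) : Function.Surjective (smashInd X x₀ s₀) := fun β ↦ by
  set ξ : K0 (X × S2r) := pullback (prX X) (-(β : K0 X)) + pullback (prX X) (β : K0 X) * bottγ X
  have hL : pullback (sliceAt s₀) ξ = 0 := by rw [pullback_sliceAt_bottMap, neg_add_cancel]
  have hR : pullback (jX x₀) ξ = 0 := by
    rw [pullback_jX_bottMap_eq_zero_iff, map_neg, neg_eq_zero]; exact ⟨β.2, β.2⟩
  obtain ⟨b, hb, hbξ⟩ := exists_reduced_quotK_eq ξ (resK_wedgeXS_eq_zero hL hR)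
  refine ⟨⟨b, hb⟩, Subtype.ext ?_⟩
  rw [smashInd_apply, Subtype.coe_mk, hbξ, map_add, ind_pullback_prX, ind_pullback_prX_mul_bottγ, zero_add]

variable (X) in
/-- **Reduced Bott periodicity `K̃(X ∧ S²) ≅ K̃(X)`** (Husemöller, *Fibre Bundles*, Ch. 11 §1
Cor. 1.4 / Thm. 5.4, reduced form): for a pointed compact Hausdorff space `(X, x₀)`, the map
`b ↦ ind(q^* b)` is an isomorphism from `K̃((X × S²)/(X ∨ S²))` onto `K̃(X)` (any base point `s₀ ∈ S²`); its inverse sends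
`β` to the class `b` with `q^* b = pr₁^*β·(γ - 1)`. [cite: HusemollerFibreBundles1994, Ch. 11 Thm. 5.4] -/
def smashBott (x₀ : X) (s₀ : S2r) : Reduced (SmashS2 X x₀ s₀) (Collapse.pt (wedgeXS x₀ s₀)) ≃+ Reduced X x₀ :=
  AddEquiv.ofBijective (smashInd X x₀ s₀) ⟨smashInd_injective x₀ s₀, smashInd_surjective x₀ s₀⟩

/-- The inverse of reduced Bott periodicity: `q^*(smashBott⁻¹ β) = pr₁^*β·(γ - 1)`. [cite: HusemollerFibreBundles1994, Ch. 11 Thm. 5.4] -/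
theorem quotK_smashBott_symm (x₀ : X) (s₀ : S2r) (β : Reduced X x₀) :
    quotK (wedgeXS x₀ s₀) ((smashBott X x₀ s₀).symm β : K0 (SmashS2 X x₀ s₀)) = pullback (prX X) (β : K0 X) * (bottγ X - 1) := by
  obtain ⟨α', β', hξ⟩ := bott_surjective (quotK (wedgeXS x₀ s₀) ((smashBott X x₀ s₀).symm β : K0 (SmashS2 X x₀ s₀)))
  have hb := ((smashBott X x₀ s₀).symm β).2
  have hL := pullback_sliceLeft_quotK x₀ s₀ hb
  change pullback (sliceAt s₀) (quotK (wedgeXS x₀ s₀) _) = 0 at hL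
  rw [hξ, pullback_sliceAt_bottMap] at hL
  have hind : ind (quotK (wedgeXS x₀ s₀) ((smashBott X x₀ s₀).symm β : K0 (SmashS2 X x₀ s₀))) = β := by
    have := (smashBott X x₀ s₀).apply_symm_apply β
    exact congrArg Subtype.val this
  rw [hξ, map_add, ind_pullback_prX, ind_pullback_prX_mul_bottγ, zero_add] at hind
  rw [hind] at hL hξ
  have hα : α' = -(β : K0 X) := eq_neg_of_add_eq_zero_left hL
  rw [hξ, hα, map_neg, mul_sub, mul_one]; abel

end Smash

end Literature.AlgebraicTopology.KTheory

end
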